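import Summits.NavierStokesRegularity.FunctionalMining.TopEigDensitySimplePoint
import HarnessLib

/-!
# FunctionalMining — local torus calculus in the chart at a point: directional derivatives through
# the re-centred lift, `Δ = ∑ₖ ∂ₖ∂ₖ` from `C²` AT A POINT, and the one-variable `(ℓ^q)″` rule

Search for candidate a priori estimates; no regularity claim. Cell `pub-nsfunc`, prove seat
(gen 23). The tree's torus calculus (`Literature.Analysis.FunctionSpaces.TorusCalculus[Proofs]`) is
stated for GLOBALLY smooth functions (`Torus.IsSmooth`). The top strain eigenvalue `λ₁(S(v))` is only
smooth on the open set where it is simple, so F1 PART I's density identity needs the same calculus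
from smoothness of the re-centred lift `liftAt f x : w ↦ f(x + proj w)` AT `w = 0` only:

* `TopEig.liftAt_add_proj` — chart shift `liftAt f (x + proj w) = liftAt f x ∘ (w + ·)`;
* `TopEig.lineDeriv_eq_fderiv_liftAt`, `TopEig.partialDeriv_eq_fderiv_liftAt` — `∂_V f(x + proj w)
  = D(liftAt f x)(w) V` wherever the lift is differentiable;
* `TopEig.partialDeriv_partialDeriv_eq_deriv_deriv` — `∂ₖ∂ₖf(x) = (t ↦ f(x + t eₖ))″(0)`, NO
  hypotheses (base-point shift);
* `TopEig.lineDeriv_lineDeriv_eq_fderiv_fderiv`, **`TopEig.laplacian_eq_sum_partialDeriv_partialDeriv_of_contDiffAt`**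
  — if `liftAt f x` is `C²` at `0` then `Δf(x) = ∑ₖ ∂ₖ∂ₖf(x)` (the tree's
  `laplacian_eq_sum_partialDeriv_partialDeriv` asks `IsSmooth f`);
* `TopEig.contDiffAt_liftAt_of_shift`, `TopEig.eventually_nhds_of_chart` — bookkeeping between the
  chart at `x`, the chart at `x + proj w`, and torus neighbourhoods of `x`;
* `TopEig.differentiableAt_deriv_of_contDiffAt`, **`TopEig.hasDerivAt_deriv_rpow`** — for
  `ℓ : ℝ → ℝ` differentiable near `t₀`, twice at `t₀`, `ℓ(t₀) > 0`:
  `(ℓ^q)″(t₀) = q(q−1)ℓ^{q−2}(ℓ′)² + qℓ^{q−1}ℓ″`.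

[folklore]
-/

noncomputable section

open Filter Topology Matrix
open scoped ContDiff

namespace Summit.NavierStokesRegularity.FunctionalMining

open Literature.Analysis Literature.Analysis.FunctionSpaces Literature.Analysis.FunctionSpaces.Torus

namespace TopEig

/-! ## 1. Directional derivatives through the re-centred lift -/

section Chart

variable {F : Type*} {d : Type*}

/-- **Chart shift**: the lift re-centred at `x + proj w` is the lift at `x` translated by `w`.
[folklore] -/
theorem liftAt_add_proj (f : UnitAddTorus d → F) (x : UnitAddTorus d) (w : EuclideanSpace ℝ d) :
    liftAt f (x + proj w) = fun z => liftAt f x (w + z) := by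
  funext z
  simp [add_assoc]

/-- **Chart neighbourhoods are torus neighbourhoods**: a property holding for `x + proj w`, `w` near
`0` in `ℝ^d`, holds for `y` near `x` on the torus (`proj` is an open quotient map). [folklore] -/
theorem eventually_nhds_of_chart {x : UnitAddTorus d} {P : UnitAddTorus d → Prop}
    (h : ∀ᶠ w in 𝓝 (0 : EuclideanSpace ℝ d), P (x + proj w)) : ∀ᶠ y in 𝓝 x, P y := by
  have h1 : Filter.map (proj : EuclideanSpace ℝ d → UnitAddTorus d) (𝓝 0) = 𝓝 0 := by
    rw [isOpenQuotientMap_proj.isOpenMap.map_nhds_eq continuous_proj.continuousAt, proj_zero]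
  have h2 : Filter.map (fun y : UnitAddTorus d => x + y) (𝓝 0) = 𝓝 x := by
    simp
  have hmap : Filter.map (fun w : EuclideanSpace ℝ d => x + proj w) (𝓝 0) = 𝓝 x := by
    rw [show (fun w : EuclideanSpace ℝ d => x + proj w) = (fun y : UnitAddTorus d => x + y) ∘ proj
      from rfl, ← Filter.map_map, h1, h2]
  rw [← hmap]
  exact h

variable [NormedAddCommGroup F] [NormedSpace ℝ F] [Fintype d]

/-- **The torus directional derivative at `x + proj w` is the Fréchet derivative of the lift at `x`,
taken at `w`**, whenever that lift is differentiable at `w`. [folklore] -/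
theorem lineDeriv_eq_fderiv_liftAt {f : UnitAddTorus d → F} {x : UnitAddTorus d}
    {w : EuclideanSpace ℝ d} (hf : DifferentiableAt ℝ (liftAt f x) w) (V : EuclideanSpace ℝ d) :
    Torus.lineDeriv f (x + proj w) V = fderiv ℝ (liftAt f x) w V := by
  unfold Torus.lineDeriv
  have hl : HasDerivAt (fun t : ℝ => w + t • V) V 0 := by
    simpa using ((hasDerivAt_id (0 : ℝ)).smul_const V).const_add w
  have hf' : DifferentiableAt ℝ (liftAt f x) (w + (0 : ℝ) • V) := by
    rw [zero_smul, add_zero]; exact hf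
  have hc := hf'.hasFDerivAt.comp_hasDerivAt (0 : ℝ) hl
  rw [zero_smul, add_zero] at hc
  have hfun : (fun t : ℝ => f (x + proj w + proj (t • V))) = liftAt f x ∘ fun t : ℝ => w + t • V := by
    funext t
    simp [add_assoc]
  rw [hfun]
  exact hc.deriv

/-- **`∂ₖ f(x + proj w) = D(liftAt f x)(w) eₖ`** wherever the lift is differentiable. [folklore] -/
theorem partialDeriv_eq_fderiv_liftAt [DecidableEq d] {f : UnitAddTorus d → F} {x : UnitAddTorus d}
    {w : EuclideanSpace ℝ d} (hf : DifferentiableAt ℝ (liftAt f x) w) (k : d) :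
    Torus.partialDeriv k f (x + proj w) = fderiv ℝ (liftAt f x) w (EuclideanSpace.single k (1 : ℝ)) :=
  lineDeriv_eq_fderiv_liftAt hf _

omit [Fintype d] in
/-- **`∂ₖ∂ₖ f(x)` is the second derivative at `0` of the line function `t ↦ f(x + t eₖ)`** — a purely
formal identity (the line function of `∂ₖ f` is the derivative of the line function, by the base-point
shift `x + proj(t eₖ) + proj(s eₖ) = x + proj((t + s) eₖ)`); no differentiability is assumed.
[folklore] -/
theorem partialDeriv_partialDeriv_eq_deriv_deriv [Fintype d] [DecidableEq d] (f : UnitAddTorus d → F)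
    (x : UnitAddTorus d) (k : d) :
    Torus.partialDeriv k (Torus.partialDeriv k f) x =
      deriv (deriv fun u : ℝ => f (x + proj (u • EuclideanSpace.single k (1 : ℝ)))) 0 := by
  set K : EuclideanSpace ℝ d := EuclideanSpace.single k (1 : ℝ) with hK
  have hshift : (fun t : ℝ => Torus.partialDeriv k f (x + proj (t • K))) =
      deriv fun t : ℝ => f (x + proj (t • K)) := by
    funext t
    show deriv (fun s : ℝ => f (x + proj (t • K) + proj (s • EuclideanSpace.single k (1 : ℝ)))) 0 = _
    have hcomp : (fun s : ℝ => f (x + proj (t • K) + proj (s • EuclideanSpace.single k (1 : ℝ)))) =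
        fun s : ℝ => f (x + proj ((t + s) • K)) := by
      funext s; rw [← hK, coordLine_add]
    rw [hcomp]
    have h := deriv_comp_const_add (f := fun u : ℝ => f (x + proj (u • K))) (a := t) (x := (0 : ℝ))
    rw [add_zero] at h
    exact h
  show deriv (fun t : ℝ => Torus.partialDeriv k f (x + proj (t • EuclideanSpace.single k (1 : ℝ)))) 0 = _
  rw [← hK, hshift]

/-- **Second directional derivatives from `C²` at the point**: if `liftAt f x` is `C²` at `0` then
`∂_V ∂_V f(x) = D²(liftAt f x)(0)[V, V]`. [folklore] -/
theorem lineDeriv_lineDeriv_eq_fderiv_fderiv {f : UnitAddTorus d → F} {x : UnitAddTorus d}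
    (hf : ContDiffAt ℝ 2 (liftAt f x) 0) (V : EuclideanSpace ℝ d) :
    Torus.lineDeriv (fun y => Torus.lineDeriv f y V) x V = fderiv ℝ (fderiv ℝ (liftAt f x)) 0 V V := by
  -- the lift is differentiable near `0`, its derivative is differentiable at `0`
  have h1 : ∀ᶠ w in 𝓝 (0 : EuclideanSpace ℝ d), DifferentiableAt ℝ (liftAt f x) w := by
    filter_upwards [hf.eventually (by simp)] with w hw
    exact hw.differentiableAt (by simp)
  have h2 : DifferentiableAt ℝ (fderiv ℝ (liftAt f x)) ((0 : ℝ) • V) := by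
    rw [zero_smul]
    exact (hf.fderiv_right (m := 1) (by norm_num)).differentiableAt (by simp)
  -- the line `t ↦ t V` and the pulled-back neighbourhood
  have hline : HasDerivAt (fun s : ℝ => s • V) V 0 := by
    simpa using (hasDerivAt_id (0 : ℝ)).smul_const V
  have hK0 : Tendsto (fun u : ℝ => u • V) (𝓝 0) (𝓝 0) := by
    have hc : Continuous fun u : ℝ => u • V := continuous_id.smul continuous_const
    simpa using hc.tendsto 0
  -- the line function of `∂_V f` near `0` is `u ↦ D(liftAt f x)(uV) V`
  have heq : (fun u : ℝ => Torus.lineDeriv f (x + proj (u • V)) V) =ᶠ[𝓝 0]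
      fun u => (fderiv ℝ (liftAt f x) ∘ fun s : ℝ => s • V) u V := by
    filter_upwards [hK0.eventually h1] with u hu
    exact lineDeriv_eq_fderiv_liftAt hu V
  -- differentiate it at `0`
  have hc := h2.hasFDerivAt.comp_hasDerivAt (0 : ℝ) hline
  have h : HasDerivAt (fun u : ℝ => (fderiv ℝ (liftAt f x) ∘ fun s : ℝ => s • V) u V)
      (fderiv ℝ (fderiv ℝ (liftAt f x)) ((0 : ℝ) • V) V V +
        (fderiv ℝ (liftAt f x) ∘ fun s : ℝ => s • V) 0 0) 0 :=
    hc.clm_apply (hasDerivAt_const (0 : ℝ) V)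
  rw [map_zero, add_zero, zero_smul] at h
  have hE : Torus.lineDeriv (fun y => Torus.lineDeriv f y V) x V =
      deriv (fun u : ℝ => Torus.lineDeriv f (x + proj (u • V)) V) 0 := rfl
  rw [hE, heq.deriv_eq, h.deriv]

/-- **`Δf(x) = ∑ₖ ∂ₖ∂ₖ f(x)` FROM `C²` AT THE POINT.** If the re-centred lift `liftAt f x` is `C²` at
`0`, the torus Laplacian at `x` (Mathlib's `Δ` of the lift at `0`) is the sum of the pure second partial
derivatives. Local form of the tree's `Torus.laplacian_eq_sum_partialDeriv_partialDeriv`. [folklore] -/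
theorem laplacian_eq_sum_partialDeriv_partialDeriv_of_contDiffAt [DecidableEq d]
    {f : UnitAddTorus d → F} {x : UnitAddTorus d} (hf : ContDiffAt ℝ 2 (liftAt f x) 0) :
    Torus.laplacian f x = ∑ k, Torus.partialDeriv k (Torus.partialDeriv k f) x := by
  rw [Torus.laplacian,
    InnerProductSpace.laplacian_eq_iteratedFDeriv_orthonormalBasis _ (EuclideanSpace.basisFun d ℝ)]
  refine Finset.sum_congr rfl fun k _ => ?_
  rw [iteratedFDeriv_two_apply]
  simp only [EuclideanSpace.basisFun_apply, Matrix.cons_val_zero, Matrix.cons_val_one]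
  rw [← lineDeriv_lineDeriv_eq_fderiv_fderiv hf]
  rfl

/-- **From the chart at `x + proj w` back to the chart at `x`**: smoothness of `liftAt f (x + proj w)`
at `0` is smoothness of `liftAt f x` at `w`. [folklore] -/
theorem contDiffAt_liftAt_of_shift {n : WithTop ℕ∞} {f : UnitAddTorus d → F} {x : UnitAddTorus d}
    {w : EuclideanSpace ℝ d} (h : ContDiffAt ℝ n (liftAt f (x + proj w)) 0) :
    ContDiffAt ℝ n (liftAt f x) w := by
  have hfun : liftAt f x = liftAt f (x + proj w) ∘ fun z => -w + z := by
    funext z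
    rw [liftAt_add_proj]
    simp
  have h' : ContDiffAt ℝ n (liftAt f (x + proj w)) ((fun z : EuclideanSpace ℝ d => -w + z) w) := by
    rw [show (fun z : EuclideanSpace ℝ d => -w + z) w = 0 by simp]
    exact h
  rw [hfun]
  exact h'.comp w (contDiff_const.add contDiff_id).contDiffAt

end Chart

/-! ## 2. One-variable tools: `ℓ″` from `C²`, and `(ℓ^q)″` -/

/-- A real function `C²` at a point has a derivative function differentiable at that point.
[folklore] -/
theorem differentiableAt_deriv_of_contDiffAt {ℓ : ℝ → ℝ} {t₀ : ℝ} (h : ContDiffAt ℝ 2 ℓ t₀) :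
    DifferentiableAt ℝ (deriv ℓ) t₀ := by
  have h1 : ContDiffAt ℝ 1 (fderiv ℝ ℓ) t₀ := h.fderiv_right (by norm_num)
  have h2 : DifferentiableAt ℝ (fderiv ℝ ℓ) t₀ := h1.differentiableAt (by simp)
  have h3 : DifferentiableAt ℝ (fun t => fderiv ℝ ℓ t (1 : ℝ)) t₀ :=
    h2.clm_apply (differentiableAt_const _)
  exact h3

/-- **`(ℓ^q)″(t₀) = q(q−1) ℓ^{q−2} (ℓ′)² + q ℓ^{q−1} ℓ″`** for `ℓ : ℝ → ℝ` differentiable near `t₀`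
with `ℓ′(t₀) = a`, `(ℓ′)′(t₀) = b` and `ℓ(t₀) > 0` (chain rule twice; any real `q`). [folklore] -/
theorem hasDerivAt_deriv_rpow {ℓ : ℝ → ℝ} {a b t₀ : ℝ} (q : ℝ)
    (hdiff : ∀ᶠ t in 𝓝 t₀, DifferentiableAt ℝ ℓ t) (ha : HasDerivAt ℓ a t₀)
    (hb : HasDerivAt (deriv ℓ) b t₀) (hpos : 0 < ℓ t₀) :
    HasDerivAt (deriv fun t => ℓ t ^ q)
      (q * (q - 1) * ℓ t₀ ^ (q - 2) * a ^ 2 + q * ℓ t₀ ^ (q - 1) * b) t₀ := by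
  have hpos' : ∀ᶠ t in 𝓝 t₀, 0 < ℓ t := ha.continuousAt.eventually (Ioi_mem_nhds hpos)
  have h1 : ∀ᶠ t in 𝓝 t₀, HasDerivAt (fun s => ℓ s ^ q) (deriv ℓ t * q * ℓ t ^ (q - 1)) t := by
    filter_upwards [hdiff, hpos'] with t ht hp
    exact ht.hasDerivAt.rpow_const (Or.inl hp.ne')
  have hderiv : deriv (fun s => ℓ s ^ q) =ᶠ[𝓝 t₀] fun t => deriv ℓ t * q * ℓ t ^ (q - 1) :=
    h1.mono fun t ht => ht.deriv
  have hpow : HasDerivAt (fun t => ℓ t ^ (q - 1)) (a * (q - 1) * ℓ t₀ ^ (q - 1 - 1)) t₀ :=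
    ha.rpow_const (Or.inl hpos.ne')
  have hprod := (hb.mul_const q).mul hpow
  refine (hprod.congr_of_eventuallyEq hderiv).congr_deriv ?_
  rw [ha.deriv, show q - 1 - 1 = q - 2 by ring]
  ring

end TopEig

end Summit.NavierStokesRegularity.FunctionalMining

end
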